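import Summits.Langlands.Langlands.Theses.OrdinaryPrimeTransport
import Summits.Langlands.Langlands.Theorems.BaseFieldAscentReciprocityTRCMPotentialAutomorphyCMTightness
import Literature.NumberTheory.Automorphic.Qian2022PotentialAutomorphy
import Literature.NumberTheory.Automorphic.ACCAutomorphyLiftingCrystalline
import Literature.NumberTheory.GaloisRepresentations.CrystallineOrdinary
import Literature.NumberTheory.GaloisRepresentations.LabelledHodgeTateWeights
import Literature.NumberTheory.GaloisRepresentations.CrystallineDeformationRing
import Literature.NumberTheory.GaloisRepresentations.RestrictFieldSelf
import HarnessLib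

/-!
# F3 WITNESS — line `FontaineLaffaillePotentialAutomorphyCM` (crux `ReciprocityUpToIrreducibility`, item stmt-Langlands-14328)
# forward generator G4 ladder-down, generation 30 — the rung family SPECIALISES to its proved floor (0 sorry)

DIAL θ32 = the `p`-adic Hodge type at `v ∣ ℓ` in single-representation potential automorphy over CM fields without
self-duality (family `PotAutCM θ`, cumulative cells, `family_mono`).  FLOOR θ = 0 = Qian 2023 Thm. 1.4 in the
crystalline-ordinary case (named text fact `Qian2023OrdinaryPotentialAutomorphyText`, a weakening of the printed
theorem; the tree's vendored rendering with Artin/pst data parameters is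
`Literature.NumberTheory.Automorphic.Qian2022.potentialAutomorphy_ordinary`).  BRIDGE `floor_qian :
Qian2023OrdinaryPotentialAutomorphyText → PotAutCM 0` and the literal F3 `example`; `floorFamily_of_rung : rung → PotAutCM 0`
orders the ladder.  RUNG θ = 2 = `FontaineLaffaillePotentialAutomorphyCM` (skeleton `Lines/FontaineLaffaillePotentialAutomorphyCM.lean`).
This file is self-contained (same definitions as the skeleton's §1–§3, namespace suffix `.Special`).
-/

noncomputable section

set_option linter.dupNamespace false

open scoped MatrixGroups Matrix NumberField Classical TensorProduct
open Filter IsDedekindDomain Field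
open Literature.NumberTheory.Automorphic Literature.NumberTheory.GaloisRepresentations
open Literature.NumberTheory.PAdicHodge
open Summit.Langlands

namespace Summit.Langlands.Langlands.Cruxes.ReciprocityUpToIrreducibility.FontaineLaffaillePotentialAutomorphyCM.Special

/-! ## 1. The graded local clause and the family -/

section Clauses

variable (K : Type) [Field K] [NumberField K] (ℓ : ℕ) [Fact ℓ.Prime] {n : ℕ}
  (r : FramedGaloisRep K (PadicAlgCl ℓ) n) (v : HeightOneSpectrum (𝓞 K)) (hv : ((ℓ : ℕ) : 𝓞 K) ∈ v.asIdeal)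

/-- Cell θ = 0 at `v ∣ ℓ` (FLOOR, Qian 2023 Thm. 1.4 / Def. 1.2 in the crystalline-ordinary case): de Rham for
the pinned Fontaine datum and crystalline-ordinary with strictly decreasing cyclotomic exponents. -/
def OrdClause : Prop :=
  (fontainePstAdicCompletion v ℓ hv).IsDeRhamFramed (r.toLocal v) ∧ r.IsCrystallineOrdinaryAt ℓ v

/-- Cell θ = 1 at `v ∣ ℓ` (the consecutive-weight Fontaine–Laffaille cell of route `StickelbergerDial`,
`WeightZeroNonOrdinaryPA`): `ℓ` unramified in `K`, `r|_{Γ_{K_v}}` crystalline for the pinned datum, labelled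
Hodge–Tate weights `{0, …, n-1}` at every `ℚ_ℓ`-label. -/
def FLConsecutiveClause : Prop :=
  Algebra.IsUnramifiedIn (𝓞 K) (Ideal.span {(ℓ : ℤ)}) ∧
    (let D := fontainePstAdicCompletion v ℓ hv
     D.IsCrystallineFramed (r.toLocal v) ∧
       (letI := D.algebra
        ∀ τ' : v.adicCompletion K →ₐ[ℚ_[ℓ]] PadicAlgCl ℓ,
          r.labelledHodgeTateWeightsAt v D.algebra D.𝔅 τ'.toRingHom = (Multiset.range n).map fun i : ℕ => (i : ℤ)))

/-- Cell θ = 2 at `v ∣ ℓ` (THE RUNG's clause, Fontaine–Laffaille of ARBITRARY regular weight): `ℓ` unramified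
in `K`, `r|_{Γ_{K_v}}` crystalline for the pinned datum, labelled Hodge–Tate weights pairwise distinct and of
spread `≤ ℓ - 2` at every `ℚ_ℓ`-label. -/
def FLClause : Prop :=
  Algebra.IsUnramifiedIn (𝓞 K) (Ideal.span {(ℓ : ℤ)}) ∧
    (let D := fontainePstAdicCompletion v ℓ hv
     D.IsCrystallineFramed (r.toLocal v) ∧
       (letI := D.algebra
        ∀ τ' : v.adicCompletion K →ₐ[ℚ_[ℓ]] PadicAlgCl ℓ,
          (r.labelledHodgeTateWeightsAt v D.algebra D.𝔅 τ'.toRingHom).Nodup ∧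
            ∀ a ∈ r.labelledHodgeTateWeightsAt v D.algebra D.𝔅 τ'.toRingHom,
              ∀ b ∈ r.labelledHodgeTateWeightsAt v D.algebra D.𝔅 τ'.toRingHom, a - b ≤ (ℓ : ℤ) - 2))

/-- Cell θ = 3 at `v ∣ ℓ` (the whole regular sector): de Rham for the pinned datum with pairwise distinct
labelled Hodge–Tate weights at every `ℚ_ℓ`-label. -/
def RegularClause : Prop :=
  let D := fontainePstAdicCompletion v ℓ hv
  D.IsDeRhamFramed (r.toLocal v) ∧
    (letI := D.algebra
     ∀ τ' : v.adicCompletion K →ₐ[ℚ_[ℓ]] PadicAlgCl ℓ,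
       (r.labelledHodgeTateWeightsAt v D.algebra D.𝔅 τ'.toRingHom).Nodup)

/-- **The graded local clause** (cumulative disjunction, so monotone in θ by construction). -/
def LocalClause (θ : ℕ) : Prop :=
  OrdClause K ℓ r v hv ∨ (1 ≤ θ ∧ FLConsecutiveClause K ℓ r v hv) ∨ (2 ≤ θ ∧ FLClause K ℓ r v hv) ∨
    (3 ≤ θ ∧ RegularClause K ℓ r v hv)

variable {K ℓ r v hv}

theorem localClause_mono {θ θ' : ℕ} (hθ : θ ≤ θ') (h : LocalClause K ℓ r v hv θ) :
    LocalClause K ℓ r v hv θ' := by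
  rcases h with h | ⟨h1, h⟩ | ⟨h2, h⟩ | ⟨h3, h⟩
  · exact Or.inl h
  · exact Or.inr (Or.inl ⟨h1.trans hθ, h⟩)
  · exact Or.inr (Or.inr (Or.inl ⟨h2.trans hθ, h⟩))
  · exact Or.inr (Or.inr (Or.inr ⟨h3.trans hθ, h⟩))

/-- Every cell is de Rham for the pinned datum (crystalline ⇒ de Rham, `IsCrystallineFramed.isDeRhamFramed`). -/
theorem isDeRhamFramed_of_localClause {θ : ℕ} (h : LocalClause K ℓ r v hv θ) :
    (fontainePstAdicCompletion v ℓ hv).IsDeRhamFramed (r.toLocal v) := by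
  rcases h with h | ⟨-, h⟩ | ⟨-, h⟩ | ⟨-, h⟩
  · exact h.1
  · exact h.2.1.isDeRhamFramed
  · exact h.2.1.isDeRhamFramed
  · exact h.1

end Clauses

/-- The residual hypotheses of Qian 2023 Thm. 1.4 = ACC+ Thm. 6.1.1 (3)–(4), on a residual representation
`τ` of `r` (`𝔽̄_ℓ`-coefficients): absolutely irreducible, decomposed generic, `τ|_{Γ_{K(ζ_ℓ)}}` absolutely
irreducible with enormous image, and a scalar `τ σ` for some `σ ∉ Γ_{K(ζ_ℓ)}`. -/
def ResidualHyp (K : Type) [Field K] [NumberField K] (ℓ : ℕ) [Fact ℓ.Prime] {n : ℕ}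
    (r : FramedGaloisRep K (PadicAlgCl ℓ) n)
    (τ : absoluteGaloisGroup K →* GL (Fin n) (padicAlgClResidueField ℓ)) : Prop :=
  r.IsResidualRepOf (RingHom.id _) τ ∧ IsAbsIrreducible τ ∧ IsDecomposedGeneric τ ∧
    IsAbsIrreducible (τ.comp (absGaloisGroupAdjoinRootsOfUnity K ℓ).subtype) ∧
    Subgroup.IsEnormous ((absGaloisGroupAdjoinRootsOfUnity K ℓ).map τ) ∧
    ∃ σ : absoluteGaloisGroup K, σ ∉ absGaloisGroupAdjoinRootsOfUnity K ℓ ∧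
      ∃ c : padicAlgClResidueField ℓ, (τ σ).1 = c • 1

/-- **Potential weak automorphy over a CM Galois extension** (the common conclusion of every cell): a number
field `K' ⊇ K`, Galois over `K` and CM, and an L-algebraic cuspidal `π'` of `GL_n(𝔸_{K'})` Satake–Frobenius
compatible with `r|_{Γ_{K'}}` at all but finitely many places. -/
def PotentiallyWeaklyAutomorphicCM (K : Type) [Field K] [NumberField K] (ℓ : ℕ) [Fact ℓ.Prime] {n : ℕ}
    (ι : PadicAlgCl ℓ ≃+* ℂ) (r : FramedGaloisRep K (PadicAlgCl ℓ) n) : Prop :=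
  ∃ (K' : Type) (_ : Field K') (_ : NumberField K') (_ : Algebra K K') (_ : IsGalois K K'),
    NumberField.IsCMField K' ∧
      ∃ (hcpt' : isCompact_glFiniteIntegralLevel n K') (π' : CuspidalAutomorphicRepData n K' hcpt'),
        π'.1.IsLAlgebraic ∧
          ∀ᶠ w : HeightOneSpectrum (𝓞 K') in cofinite, SatakeFrobCompatibleAt ι π'.1 (r.restrictField K') w

/-- The family over an arbitrary hypothesis `H` on `(K, ℓ, r)` (used for the cells and their complements). -/
def PotAutCMOn
    (H : ∀ (K : Type) [Field K] [NumberField K] (ℓ : ℕ) [Fact ℓ.Prime] (n : ℕ),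
      FramedGaloisRep K (PadicAlgCl ℓ) n → Prop) : Prop :=
  ∀ (K : Type) [Field K] [NumberField K], NumberField.IsCMField K →
    ∀ (n : ℕ), 2 ≤ n →
    ∀ (ℓ : ℕ) [Fact ℓ.Prime] (ι : PadicAlgCl ℓ ≃+* ℂ) (r : FramedGaloisRep K (PadicAlgCl ℓ) n)
      (τ : absoluteGaloisGroup K →* GL (Fin n) (padicAlgClResidueField ℓ)),
      r.toGaloisRep.IsIrreducible →
      (∀ᶠ v : HeightOneSpectrum (𝓞 K) in cofinite, r.IsUnramifiedAt v) →
      H K ℓ n r → ResidualHyp K ℓ r τ → PotentiallyWeaklyAutomorphicCM K ℓ ι r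

/-- The hypothesis of cell θ: the graded local clause at EVERY `v ∣ ℓ`. -/
def CellHyp (θ : ℕ) (K : Type) [Field K] [NumberField K] (ℓ : ℕ) [Fact ℓ.Prime] (n : ℕ)
    (r : FramedGaloisRep K (PadicAlgCl ℓ) n) : Prop :=
  ∀ (v : HeightOneSpectrum (𝓞 K)) (hv : ((ℓ : ℕ) : 𝓞 K) ∈ v.asIdeal), LocalClause K ℓ r v hv θ

/-- **THE FAMILY** `PotAutCM θ`: single-representation potential weak automorphy over CM fields for irreducible
`r` with big residual image whose local type at every `v ∣ ℓ` lies in cell θ. -/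
def PotAutCM (θ : ℕ) : Prop :=
  PotAutCMOn (CellHyp θ)

/-- **THE RUNG (crux #1 of the ladder)**: `PotAutCM 2` — Fontaine–Laffaille crystalline of ARBITRARY regular
weight (or crystalline-ordinary) at every `v ∣ ℓ`, `ℓ` unramified in the CM field `K`, no self-duality. -/
def FontaineLaffaillePotentialAutomorphyCM : Prop :=
  PotAutCM 2

/-! ## 2. Monotonicity (bookkeeping) -/

theorem cellHyp_mono {θ θ' : ℕ} (hθ : θ ≤ θ') {K : Type} [Field K] [NumberField K] {ℓ : ℕ} [Fact ℓ.Prime]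
    {n : ℕ} {r : FramedGaloisRep K (PadicAlgCl ℓ) n} (h : CellHyp θ K ℓ n r) : CellHyp θ' K ℓ n r :=
  fun v hv => localClause_mono hθ (h v hv)

theorem potAutCMOn_mono
    {H H' : ∀ (K : Type) [Field K] [NumberField K] (ℓ : ℕ) [Fact ℓ.Prime] (n : ℕ),
      FramedGaloisRep K (PadicAlgCl ℓ) n → Prop}
    (hHH' : ∀ (K : Type) [Field K] [NumberField K] (ℓ : ℕ) [Fact ℓ.Prime] (n : ℕ)
      (r : FramedGaloisRep K (PadicAlgCl ℓ) n), H K ℓ n r → H' K ℓ n r)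
    (h : PotAutCMOn H') : PotAutCMOn H :=
  fun K _ _ hK n hn ℓ _ ι r τ hirr hur hH hres => h K hK n hn ℓ ι r τ hirr hur (hHH' K ℓ n r hH) hres

/-- **Dial monotonicity** (a larger θ is a stronger statement). -/
theorem family_mono {θ θ' : ℕ} (hθ : θ ≤ θ') (h : PotAutCM θ') : PotAutCM θ :=
  potAutCMOn_mono (fun _ _ _ _ _ _ _ hH => cellHyp_mono hθ hH) h

@[aesop safe apply]
theorem floorFamily_of_rung (h : FontaineLaffaillePotentialAutomorphyCM) : PotAutCM 0 :=
  family_mono (Nat.zero_le 2) h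

theorem consecutiveCell_of_rung (h : FontaineLaffaillePotentialAutomorphyCM) : PotAutCM 1 :=
  family_mono one_le_two h

/-! ## 3. The floor (F3): Qian 2023 Thm. 1.4, crystalline-ordinary case -/

/-- **Qian 2023, Theorem 1.4 — crystalline-ordinary case, a.e.-Satake conclusion** (NAMED TEXT FACT, the floor
of the ladder).  L. Qian, *Potential automorphy for `GL_n`*, Invent. Math. 231 (2023) 1239–1275 (arXiv:2104.09761),
Thm. 1.4 (p. 2) with Def. 1.2–1.3, read in the tree's vocabulary exactly as the accepted
`Literature.NumberTheory.Automorphic.Qian2022.potentialAutomorphy_ordinary` EXCEPT: (a) hypothesis (ii)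
"potentially semistable, ordinary with regular Hodge–Tate weights at `v ∣ l`" is SPECIALISED to "de Rham for the
pinned Fontaine datum and crystalline-ordinary with strictly decreasing cyclotomic exponents"
(`IsCrystallineOrdinaryAt`: a full `Γ_{K_v}`-stable flag with graded pieces `ψ_i ε^{b_i}`, `ψ_i` UNRAMIFIED,
`b` strictly decreasing — the case of Def. 1.2 in which the characters `χ_i ∘ Art_{K_v}|_{𝒪^×}` are the algebraic
characters `∏_τ τ^{-μ_{τ,i}}` on all of `𝒪_{K_v}^×` with `μ_τ` strictly monotone, i.e. no finite-order
ramified twist; at the genuine Artin map `ε ∘ Art|_{𝒪^×} = N^{-1}`), and an irreducibility hypothesis on `r`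
is ADDED (implied anyway by absolute irreducibility of `r̄`); (b) the avoidance field is dropped (`K^{av} := K`)
and the conclusion "`r|_{Γ_{K'}} ≅ r_{l,ι}(π)`, `π` regular algebraic cuspidal of `GL_n(𝔸_{K'})`" is read for the
L-algebraic cuspidal twist `π' := π ⊗ |det|^{(1-n)/2}` (Clozel 1990 §3.5; Buzzard–Gee 2014 §5: `r_{l,ι}(π)` is
unramified at almost all `w` with `char r_{l,ι}(π)(Frob_w)` the Satake polynomial of `π'_w` in the L-normalisation
of the summit clause `SatakeFrobCompatibleAt`).  Both changes make the text WEAKER than the printed theorem.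
[cite: Qian2022, Thm. 1.4 (p. 2), Def. 1.2, Def. 1.3] [cite: ACCGHLNSTT2023, Thm. 6.1.2, Def. 4.3.1, Def. 6.2.28]
[cite: BuzzardGeeLMS2014, §5 and Conj. 3.2.1] -/
def Qian2023OrdinaryPotentialAutomorphyText : Prop :=
  ∀ (K : Type) [Field K] [NumberField K], NumberField.IsCMField K →
    ∀ (n : ℕ), 2 ≤ n →
    ∀ (ℓ : ℕ) [Fact ℓ.Prime] (ι : PadicAlgCl ℓ ≃+* ℂ) (r : FramedGaloisRep K (PadicAlgCl ℓ) n),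
      r.toGaloisRep.IsIrreducible →
      (∀ᶠ v : HeightOneSpectrum (𝓞 K) in cofinite, r.IsUnramifiedAt v) →
      (∀ (v : HeightOneSpectrum (𝓞 K)) (hv : ((ℓ : ℕ) : 𝓞 K) ∈ v.asIdeal),
        (fontainePstAdicCompletion v ℓ hv).IsDeRhamFramed (r.toLocal v) ∧ r.IsCrystallineOrdinaryAt ℓ v) →
      (∃ τ : absoluteGaloisGroup K →* GL (Fin n) (padicAlgClResidueField ℓ),
        r.IsResidualRepOf (RingHom.id _) τ ∧ IsAbsIrreducible τ ∧ IsDecomposedGeneric τ ∧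
          IsAbsIrreducible (τ.comp (absGaloisGroupAdjoinRootsOfUnity K ℓ).subtype) ∧
          Subgroup.IsEnormous ((absGaloisGroupAdjoinRootsOfUnity K ℓ).map τ) ∧
          ∃ σ : absoluteGaloisGroup K, σ ∉ absGaloisGroupAdjoinRootsOfUnity K ℓ ∧
            ∃ c : padicAlgClResidueField ℓ, (τ σ).1 = c • 1) →
      ∃ (K' : Type) (_ : Field K') (_ : NumberField K') (_ : Algebra K K') (_ : IsGalois K K'),
        NumberField.IsCMField K' ∧
          ∃ (hcpt' : isCompact_glFiniteIntegralLevel n K') (π' : CuspidalAutomorphicRepData n K' hcpt'),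
            π'.1.IsLAlgebraic ∧
              ∀ᶠ w : HeightOneSpectrum (𝓞 K') in cofinite, SatakeFrobCompatibleAt ι π'.1 (r.restrictField K') w

/-- **F3 bridge**: the floor text gives cell θ = 0. -/
theorem floor_qian (h : Qian2023OrdinaryPotentialAutomorphyText) : PotAutCM 0 := by
  intro K _ _ hK n hn ℓ _ ι r τ hirr hur hcell hres
  refine h K hK n hn ℓ ι r hirr hur (fun v hv => ?_) ⟨τ, hres⟩
  rcases hcell v hv with h0 | ⟨h1, -⟩ | ⟨h2, -⟩ | ⟨h3, -⟩
  · exact h0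
  · exact absurd h1 (by norm_num)
  · exact absurd h2 (by norm_num)
  · exact absurd h3 (by norm_num)

/-- **F3 WITNESS**: the family specialises to the proved floor at θ = 0. -/
example (h : Qian2023OrdinaryPotentialAutomorphyText) : PotAutCM 0 :=
  floor_qian h


end Summit.Langlands.Langlands.Cruxes.ReciprocityUpToIrreducibility.FontaineLaffaillePotentialAutomorphyCM.Special

end
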